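import Literature.MathematicalPhysics.QuantumLattice.HeisenbergCouplingReflection
import HarnessLib

/-!
# Dimerization for spin-Peierls in every dimension (Lieb–Nachtergaele 1995, Theorem 4)

E. H. Lieb, B. Nachtergaele, *Stability of the Peierls instability for ring-shaped molecules*,
Phys. Rev. B **51** (1995) 4777 (= cond-mat/9410100), §1 (the spin-Peierls problem, eq. (1.9))
and **Theorem 4** (`spinpeierls`): "Let `Λ ⊂ ℤ^d` be a rectangular box of even size in all
coordinate directions and with periodic boundary conditions. Then there is an energy minimizing
configuration of `J_{ij}`'s which is of periodicity 2 in all coordinate directions", for the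
functional `λ₀(Σ_{⟨i,j⟩} J_{ij} 𝐒_i·𝐒_j) + Σ_{⟨i,j⟩} f(J_{ij})` over the antiferromagnetic couplings
`J_{ij} ≥ 0` on the nearest-neighbour bonds. Proof (§3): Dyson–Lieb–Simon reflection positivity
in the couplings — the tree's `heis_groundEnergy_reflectWeight_le_zero`
(`HeisenbergCouplingReflection.lean`) — "and then in the same way as Theorem 1, but this time
there is no need to distinguish between `L ≡ 0 mod 4` and `L ≡ 2 mod 4` — or even to restrict
ourselves to one dimension."

This file carries the printed argument out on the torus `(ℤ/Lℤ)^d` (the box with all sides `L`;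
`L` even, `L ≥ 4`, any `d`, any spin `n/2`, any `f`):

* an abstract form of the PAIR COUNT of the proof of Theorem 1 (`SymCount.eqCount_symL_add`):
  for a reflection `ρ` of a finite set of bonds exchanging "left" and "right" bonds and fixing
  the cut ones, the two symmetrised configurations `J^L = (J^l, J^m, θJ^l)`, `J^R` together have at
  least twice as many coincidences `J(φ b) = J(b)` along any map `φ` compatible with `ρ`, and
  strictly more when a pair `{b, φ b} = {b, ρ b}` straddling the plane is unequal;
* the bonds `(x, k) ↦ {x, x + e_k}` of the torus, the coupling weight, the energy
  `SpinPeierls.energy n f J`, minimisers over `J ≥ 0` (`IsMinimizer`), the reflections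
  `bondRefl i a` of the bonds in the planes between the layers `a | a+1` and `a+L/2 | a+L/2+1` of
  direction `i` with the symmetrised couplings = `reflectWeightLeft/Right` of
  `HeisenbergCouplingReflection` on the bonds (`reflectWeightLeft_coupling_bond`), hence the
  reflection inequality `energy_symL_add_energy_symR_le`;
* the potential `Φ(J) = Σ_i #{b : J(b + s_i(b)) = J(b)}`, `s_i(b) = 2e_i` for bonds parallel to
  `e_i` and `e_i` for the others, which the reflections do not decrease and strictly increase at
  a suitably placed plane as long as `Φ` is not maximal (`step`); maximal `Φ` means period `1` in
  the directions transverse to each bond and period `2` along it, in particular period `2`;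
* **`exists_periodTwo_minimizer`** — Theorem 4: if the minimum over `J ≥ 0` is attained, it is
  attained at a configuration with `J_{(x + 2e_i, k)} = J_{(x, k)}` for all `x, k, i`.

The ring `d = 1` in ring coordinates (`J : ℤ/Lℤ → ℝ`, `J_{c+2} = J_c`) is
`SpinPeierlsDimerizationRing.lean`. As in the paper, the existence of a minimiser (from the growth
condition (1.6) on `f`) is not part of the statement: the theorem is about an attained minimum.

## References

* [LiebNachtergaele1995] E. H. Lieb, B. Nachtergaele, Phys. Rev. B 51 (1995) 4777, eq. (1.9),
  Theorem 4, §3 (proofs of Theorems 1 and 4).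
* [DLS1978] F. J. Dyson, E. H. Lieb, B. Simon, J. Stat. Phys. 18 (1978) 335–383 (reflection
  positivity of the antiferromagnet).
-/

noncomputable section

open Matrix Finset Literature.Probability.LatticeModels
  Literature.MathematicalPhysics.QuantumLattice.SpinOperators

namespace Literature.MathematicalPhysics.QuantumLattice

/-! ### The abstract pair count of the proof of Theorem 1 -/

namespace SymCount

variable {B : Type*} [Fintype B] [DecidableEq B] {α : Type*} [DecidableEq α]

/-- The left-symmetrised configuration `(J^l, J^m, θJ^l)`: reflected values on the right bonds.
[cite: LiebNachtergaele1995, Lemma 3.1 and §3] -/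
def symL (isR : B → Prop) [DecidablePred isR] (ρ : B → B) (J : B → α) : B → α :=
  fun b => if isR b then J (ρ b) else J b

/-- The right-symmetrised configuration `(θJ^r, J^m, J^r)`. [cite: LiebNachtergaele1995, Lemma 3.1 and §3] -/
def symR (isL : B → Prop) [DecidablePred isL] (ρ : B → B) (J : B → α) : B → α :=
  fun b => if isL b then J (ρ b) else J b

/-- The number of coincidences `J(φ b) = J(b)` ("pairs of identical `|t_j|`'s").
[cite: LiebNachtergaele1995, §3 (proof of Theorem 1)] -/
def eqCount (φ : B → B) (J : B → α) : ℕ := #(univ.filter fun b => J (φ b) = J b)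

/-- The indicator of a coincidence. [cite: LiebNachtergaele1995, §3] -/
def ind (φ : B → B) (J : B → α) (b : B) : ℕ := if J (φ b) = J b then 1 else 0

omit [DecidableEq B] in
/-- `eqCount` as a sum of indicators. [cite: LiebNachtergaele1995, §3] -/
theorem eqCount_eq_sum (φ : B → B) (J : B → α) : eqCount φ J = ∑ b, ind φ J b := card_filter _ _

omit [Fintype B] [DecidableEq B] in
/-- `ind ≤ 1`. [cite: LiebNachtergaele1995, §3] -/
theorem ind_le_one (φ : B → B) (J : B → α) (b : B) : ind φ J b ≤ 1 := by
  unfold ind; split_ifs <;> omega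

omit [DecidableEq B] in
/-- `eqCount ≤ |B|`. [cite: LiebNachtergaele1995, §3] -/
theorem eqCount_le (φ : B → B) (J : B → α) : eqCount φ J ≤ Fintype.card B :=
  (card_filter_le _ _).trans (card_univ (α := B)).le

omit [DecidableEq B] in
/-- All pairs coincide iff `eqCount = |B|`. [cite: LiebNachtergaele1995, §3] -/
theorem forall_eq_of_card_le_eqCount {φ : B → B} {J : B → α} (h : Fintype.card B ≤ eqCount φ J)
    (b : B) : J (φ b) = J b := by
  have hc : #(univ.filter fun b => J (φ b) = J b) = #(univ : Finset B) :=
    le_antisymm (card_filter_le _ _) (by rw [card_univ]; exact h)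
  exact (card_filter_eq_iff.1 hc) b (mem_univ b)

/-- A pair STRADDLES the plane: one bond left, the other right.
[cite: LiebNachtergaele1995, §3 (the pairs `|t_j| = |t_{j+2}|` for `j = L/2-1`, `L-1`)] -/
abbrev Mixed (isL isR : B → Prop) (φ : B → B) (b : B) : Prop :=
  (isL b ∧ isR (φ b)) ∨ (isR b ∧ isL (φ b))

/-- Both bonds of the pair are cut by the plane. [cite: LiebNachtergaele1995, §3] -/
abbrev BothCut (isL isR : B → Prop) (φ : B → B) (b : B) : Prop :=
  ¬isL b ∧ ¬isR b ∧ ¬isL (φ b) ∧ ¬isR (φ b)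

omit [DecidableEq B] [DecidableEq α] in
/-- **The elastic energy is split evenly by the two symmetrisations**:
`Σ f(J^L) + Σ f(J^R) = 2 Σ f(J)`. [cite: LiebNachtergaele1995, Lemma 3.1 (proof, last sentence)] -/
theorem sum_symL_add_sum_symR (isL isR : B → Prop) [DecidablePred isL] [DecidablePred isR]
    (ρ : B → B) (hρL : ∀ b, isL b → isR (ρ b)) (hρR : ∀ b, isR b → isL (ρ b))
    (hρρ : ∀ b, ρ (ρ b) = b) (J : B → α) (f : α → ℝ) :
    ∑ b, f (symL isR ρ J b) + ∑ b, f (symR isL ρ J b) = 2 * ∑ b, f (J b) := by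
  have hsplit : ∀ (p : B → Prop) [DecidablePred p] (K : B → α), ∑ b, f (K b) =
      ∑ b ∈ univ.filter p, f (K b) + ∑ b ∈ univ.filter (fun b => ¬p b), f (K b) :=
    fun p _ K => (sum_filter_add_sum_filter_not _ _ _).symm
  have hRL : ∑ b ∈ univ.filter (fun b => isR b), f (symL isR ρ J b) =
      ∑ b ∈ univ.filter (fun b => isL b), f (J b) := by
    refine sum_nbij' ρ ρ (fun b hb => ?_) (fun b hb => ?_) (fun b _ => hρρ b) (fun b _ => hρρ b)
      (fun b hb => ?_)
    · rw [mem_filter] at hb ⊢; exact ⟨mem_univ _, hρR b hb.2⟩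
    · rw [mem_filter] at hb ⊢; exact ⟨mem_univ _, hρL b hb.2⟩
    · rw [mem_filter] at hb; rw [symL, if_pos hb.2]
  have hRn : ∑ b ∈ univ.filter (fun b => ¬isR b), f (symL isR ρ J b) =
      ∑ b ∈ univ.filter (fun b => ¬isR b), f (J b) :=
    sum_congr rfl fun b hb => by rw [mem_filter] at hb; rw [symL, if_neg hb.2]
  have hLR : ∑ b ∈ univ.filter (fun b => isL b), f (symR isL ρ J b) =
      ∑ b ∈ univ.filter (fun b => isR b), f (J b) := by
    refine sum_nbij' ρ ρ (fun b hb => ?_) (fun b hb => ?_) (fun b _ => hρρ b) (fun b _ => hρρ b)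
      (fun b hb => ?_)
    · rw [mem_filter] at hb ⊢; exact ⟨mem_univ _, hρL b hb.2⟩
    · rw [mem_filter] at hb ⊢; exact ⟨mem_univ _, hρR b hb.2⟩
    · rw [mem_filter] at hb; rw [symR, if_pos hb.2]
  have hLn : ∑ b ∈ univ.filter (fun b => ¬isL b), f (symR isL ρ J b) =
      ∑ b ∈ univ.filter (fun b => ¬isL b), f (J b) :=
    sum_congr rfl fun b hb => by rw [mem_filter] at hb; rw [symR, if_neg hb.2]
  have e1 := hsplit (fun b => isR b) (symL isR ρ J)
  have e2 := hsplit (fun b => isL b) (symR isL ρ J)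
  have e3 := hsplit (fun b => isR b) J
  have e4 := hsplit (fun b => isL b) J
  rw [hRL, hRn] at e1
  rw [hLR, hLn] at e2
  linarith

omit [DecidableEq B] in
/-- **The pair count of the proof of Theorem 1, abstract form.** Bonds `B` with disjoint classes
`isL` ("left"), `isR` ("right"), the rest "cut"; a reflection `ρ` (involution, left ↔ right,
fixing cut bonds); a pairing map `φ` ("the pair `(b, φ b)`") and an involution `σ` of `B`
transporting pairs along `ρ` (`{σ b, φ(σ b)} = {ρ b, ρ(φ b)}`); and every straddling pair is a
mirror pair (`φ b = ρ b`). Then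
`N(J^L) + N(J^R) + 2·#{straddling b : J(φ b) = J b} = 2 N(J) + 2·#{straddling}` — so
"either `J^L` or `J^R` has at least as many pairs of identical couplings", strictly more when a
straddling pair is unequal. [cite: LiebNachtergaele1995, §3 (proof of Theorem 1)] -/
theorem eqCount_symL_add (isL isR : B → Prop) [DecidablePred isL] [DecidablePred isR]
    (hLR : ∀ b, isL b → ¬isR b) (ρ : B → B) (hρL : ∀ b, isL b → isR (ρ b))
    (hρR : ∀ b, isR b → isL (ρ b)) (hρC : ∀ b, ¬isL b → ¬isR b → ρ b = b)
    (hρρ : ∀ b, ρ (ρ b) = b) (φ σ : B → B) (hσσ : ∀ b, σ (σ b) = b)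
    (hσ : ∀ b, (σ b = ρ b ∧ φ (σ b) = ρ (φ b)) ∨ (σ b = ρ (φ b) ∧ φ (σ b) = ρ b))
    (hmix : ∀ b, isL b → isR (φ b) → φ b = ρ b) (hmix' : ∀ b, isR b → isL (φ b) → φ b = ρ b)
    (J : B → α) :
    eqCount φ (symL isR ρ J) + eqCount φ (symR isL ρ J) +
        2 * #((univ.filter (Mixed isL isR φ)).filter fun b => J (φ b) = J b) =
      2 * eqCount φ J + 2 * #(univ.filter (Mixed isL isR φ)) := by
  -- `ρ` exchanges the classes
  have hLρ : ∀ b, isL (ρ b) ↔ isR b := fun b =>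
    ⟨fun h => by have := hρL _ h; rwa [hρρ] at this, hρR b⟩
  have hRρ : ∀ b, isR (ρ b) ↔ isL b := fun b =>
    ⟨fun h => by have := hρR _ h; rwa [hρρ] at this, hρL b⟩
  -- values of the symmetrised configurations off the other class
  have hLval : ∀ b, ¬isR b → symL isR ρ J b = J b := fun b hb => by rw [symL, if_neg hb]
  have hLval' : ∀ b, ¬isL b → symL isR ρ J b = J (ρ b) := fun b hb => by
    by_cases hr : isR b
    · rw [symL, if_pos hr]
    · rw [symL, if_neg hr, hρC b hb hr]
  have hRval : ∀ b, ¬isL b → symR isL ρ J b = J b := fun b hb => by rw [symR, if_neg hb]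
  have hRval' : ∀ b, ¬isR b → symR isL ρ J b = J (ρ b) := fun b hb => by
    by_cases hl : isL b
    · rw [symR, if_pos hl]
    · rw [symR, if_neg hl, hρC b hl hb]
  -- the indicator of the transported pair
  have hσind : ∀ b, ind φ J (σ b) = if J (ρ (φ b)) = J (ρ b) then 1 else 0 := by
    intro b
    rcases hσ b with ⟨h1, h2⟩ | ⟨h1, h2⟩
    · rw [ind, h2, h1]
    · rw [ind, h2, h1]; exact if_congr eq_comm rfl rfl
  -- pointwise identity
  have hpt : ∀ b, ind φ (symL isR ρ J) b + ind φ (symR isL ρ J) b +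
      2 * (if Mixed isL isR φ b then ind φ J b else 0) +
      (if ¬Mixed isL isR φ b ∧ ¬BothCut isL isR φ b then ind φ J b else 0) =
      2 * ind φ J b + 2 * (if Mixed isL isR φ b then 1 else 0) +
      (if ¬Mixed isL isR φ b ∧ ¬BothCut isL isR φ b then ind φ J (σ b) else 0) := by
    intro b
    by_cases hm : Mixed isL isR φ b
    · -- straddling: both symmetrised pairs coincide
      have h1 : ind φ (symL isR ρ J) b = 1 := by
        rw [ind, if_pos]
        rcases hm with ⟨hl, hr⟩ | ⟨hr, hl⟩
        · rw [hLval b (hLR b hl), hLval' (φ b) (fun h => hLR _ h hr), hmix b hl hr, hρρ]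
        · rw [hLval (φ b) (hLR _ hl), hLval' b (fun h => hLR _ h hr), hmix' b hr hl]
      have h2 : ind φ (symR isL ρ J) b = 1 := by
        rw [ind, if_pos]
        rcases hm with ⟨hl, hr⟩ | ⟨hr, hl⟩
        · rw [hRval (φ b) (fun h => hLR _ h hr), hRval' b (hLR b hl), hmix b hl hr]
        · rw [hRval b (fun h => hLR _ h hr), hRval' (φ b) (hLR _ hl), hmix' b hr hl, hρρ]
      have h3 : ¬(¬Mixed isL isR φ b ∧ ¬BothCut isL isR φ b) := fun h => h.1 hm
      rw [h1, h2, if_pos hm, if_pos hm, if_neg h3, if_neg h3]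
      ring
    · by_cases hc : BothCut isL isR φ b
      · obtain ⟨h1, h2, h3, h4⟩ := hc
        have e1 : ind φ (symL isR ρ J) b = ind φ J b := by rw [ind, ind, hLval b h2, hLval _ h4]
        have e2 : ind φ (symR isL ρ J) b = ind φ J b := by rw [ind, ind, hRval b h1, hRval _ h3]
        have h5 : ¬(¬Mixed isL isR φ b ∧ ¬BothCut isL isR φ b) := fun h => h.2 ⟨h1, h2, h3, h4⟩
        rw [e1, e2, if_neg hm, if_neg hm, if_neg h5, if_neg h5]
        ring
      · have h5 : ¬Mixed isL isR φ b ∧ ¬BothCut isL isR φ b := ⟨hm, hc⟩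
        rw [if_neg hm, if_neg hm, if_pos h5, if_pos h5, hσind]
        -- no straddling: either no right bond or no left bond in the pair
        by_cases hnoR : ¬isR b ∧ ¬isR (φ b)
        · have e1 : ind φ (symL isR ρ J) b = ind φ J b := by
            rw [ind, ind, hLval b hnoR.1, hLval _ hnoR.2]
          have e2 : ind φ (symR isL ρ J) b = if J (ρ (φ b)) = J (ρ b) then 1 else 0 := by
            rw [ind, hRval' b hnoR.1, hRval' _ hnoR.2]
          rw [e1, e2]; ring
        · have hnoL : ¬isL b ∧ ¬isL (φ b) := by
            constructor
            · intro hl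
              have hr : ¬isR b := hLR b hl
              have : isR (φ b) := by by_contra h; exact hnoR ⟨hr, h⟩
              exact hm (Or.inl ⟨hl, this⟩)
            · intro hl
              have hr : ¬isR (φ b) := hLR _ hl
              have : isR b := by by_contra h; exact hnoR ⟨h, hr⟩
              exact hm (Or.inr ⟨this, hl⟩)
          have e1 : ind φ (symL isR ρ J) b = if J (ρ (φ b)) = J (ρ b) then 1 else 0 := by
            rw [ind, hLval' b hnoL.1, hLval' _ hnoL.2]
          have e2 : ind φ (symR isL ρ J) b = ind φ J b := by
            rw [ind, ind, hRval b hnoL.1, hRval _ hnoL.2]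
          rw [e1, e2]; ring
  -- `σ` preserves the class "neither straddling nor both cut"
  have hσclass : ∀ b, (¬Mixed isL isR φ b ∧ ¬BothCut isL isR φ b) →
      (¬Mixed isL isR φ (σ b) ∧ ¬BothCut isL isR φ (σ b)) := by
    rintro b ⟨hm, hc⟩
    dsimp only [Mixed, BothCut] at hm hc ⊢
    rcases hσ b with ⟨h1, h2⟩ | ⟨h1, h2⟩
    · rw [h2, h1]
      simp only [hLρ, hRρ]
      refine ⟨?_, ?_⟩
      · rintro (⟨h3, h4⟩ | ⟨h3, h4⟩)
        · exact hm (Or.inr ⟨h3, h4⟩)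
        · exact hm (Or.inl ⟨h3, h4⟩)
      · rintro ⟨h3, h4, h5, h6⟩; exact hc ⟨h4, h3, h6, h5⟩
    · rw [h2, h1]
      simp only [hLρ, hRρ]
      refine ⟨?_, ?_⟩
      · rintro (⟨h3, h4⟩ | ⟨h3, h4⟩)
        · exact hm (Or.inl ⟨h4, h3⟩)
        · exact hm (Or.inr ⟨h4, h3⟩)
      · rintro ⟨h3, h4, h5, h6⟩; exact hc ⟨h6, h5, h4, h3⟩
  have hσsum : ∑ b, (if ¬Mixed isL isR φ b ∧ ¬BothCut isL isR φ b then ind φ J (σ b) else 0) =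
      ∑ b, (if ¬Mixed isL isR φ b ∧ ¬BothCut isL isR φ b then ind φ J b else 0) := by
    rw [← sum_filter, ← sum_filter]
    refine sum_nbij' σ σ (fun b hb => ?_) (fun b hb => ?_) (fun b _ => hσσ b) (fun b _ => hσσ b)
      (fun b _ => rfl)
    · rw [mem_filter] at hb ⊢; exact ⟨mem_univ _, hσclass b hb.2⟩
    · rw [mem_filter] at hb ⊢; exact ⟨mem_univ _, hσclass b hb.2⟩
  -- sum the pointwise identity
  have hsum := congrArg (fun g : B → ℕ => ∑ b, g b) (funext hpt)
  simp only [sum_add_distrib, ← mul_sum] at hsum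
  rw [hσsum] at hsum
  rw [eqCount_eq_sum, eqCount_eq_sum, eqCount_eq_sum]
  simp only [card_eq_sum_ones, sum_filter]
  have e1 : ∑ b, (if Mixed isL isR φ b then ind φ J b else 0) =
      ∑ b, (if Mixed isL isR φ b then (if J (φ b) = J b then 1 else 0) else 0) :=
    sum_congr rfl fun b _ => by rfl
  rw [← e1]
  omega

end SymCount

/-! ### Bonds of the torus `(ℤ/Lℤ)^d`, the couplings and the energy -/

namespace SpinPeierls

variable {d : ℕ} {L : ℕ} [NeZero L]

/-- A nearest-neighbour bond of the torus, indexed by its lower endpoint and its direction: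
`(x, k) ↦ {x, x + e_k}`. [cite: LiebNachtergaele1995, eq. (1.9)] -/
abbrev Bond (d L : ℕ) : Type := TorusSite d L × Fin d

/-- The unit vector `e_k` of the torus. [cite: LiebNachtergaele1995, eq. (1.9)] -/
def unitVec (k : Fin d) : TorusSite d L := Pi.single k 1

/-- The bond `{x, x + e_k}` as an unordered pair of sites. [cite: LiebNachtergaele1995, eq. (1.9)] -/
def bond (b : Bond d L) : Sym2 (TorusSite d L) := s(b.1, b.1 + unitVec b.2)

omit [NeZero L] in
/-- Coordinates of the unit vectors. [cite: LiebNachtergaele1995, eq. (1.9)] -/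
theorem unitVec_apply_self (k : Fin d) : (unitVec k : TorusSite d L) k = 1 := by
  rw [unitVec, Pi.single_eq_same]

omit [NeZero L] in
/-- Coordinates of the unit vectors. [cite: LiebNachtergaele1995, eq. (1.9)] -/
theorem unitVec_apply_of_ne {k i : Fin d} (h : i ≠ k) : (unitVec k : TorusSite d L) i = 0 := by
  rw [unitVec, Pi.single_eq_of_ne h]

omit [NeZero L] in
/-- `e_k ≠ 0` (`L ≥ 2`). [cite: LiebNachtergaele1995, eq. (1.9)] -/
theorem unitVec_ne_zero (h2 : 2 ≤ L) (k : Fin d) : (unitVec k : TorusSite d L) ≠ 0 :=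
  single_ne_zero_of_two_le L h2 k

omit [NeZero L] in
/-- `e_j = e_k ↔ j = k` (`L ≥ 2`). [cite: LiebNachtergaele1995, eq. (1.9)] -/
theorem unitVec_inj (h2 : 2 ≤ L) {j k : Fin d} : (unitVec j : TorusSite d L) = unitVec k ↔ j = k := by
  refine ⟨fun h => ?_, fun h => by rw [h]⟩
  by_contra hjk
  have hj := congrFun h j
  rw [unitVec_apply_self, unitVec_apply_of_ne hjk] at hj
  haveI : Fact (1 < L) := ⟨by omega⟩
  exact one_ne_zero hj

omit [NeZero L] in
/-- `e_j + e_k ≠ 0` (`L ≥ 3`). [cite: LiebNachtergaele1995, eq. (1.9)] -/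
theorem unitVec_add_unitVec_ne_zero (h3 : 3 ≤ L) (j k : Fin d) :
    (unitVec j : TorusSite d L) + unitVec k ≠ 0 := by
  intro h
  have hj := congrFun h j
  rw [Pi.add_apply, Pi.zero_apply, unitVec_apply_self] at hj
  by_cases hjk : j = k
  · rw [hjk, unitVec_apply_self] at hj
    have h2 : ((2 : ℕ) : ZMod L) = 0 := by rw [Nat.cast_ofNat]; linear_combination hj
    rw [ZMod.natCast_eq_zero_iff] at h2
    have := Nat.le_of_dvd (by norm_num) h2
    omega
  · rw [unitVec_apply_of_ne hjk, add_zero] at hj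
    haveI : Fact (1 < L) := ⟨by omega⟩
    exact one_ne_zero hj

omit [NeZero L] in
/-- The bonds are edges of the torus graph (`L ≥ 2`). [cite: LiebNachtergaele1995, eq. (1.9)] -/
theorem adj_bond (h2 : 2 ≤ L) (b : Bond d L) : (torusGraph d L).Adj b.1 (b.1 + unitVec b.2) :=
  torusGraph_adj_add_single L h2 b.1 b.2

/-- The bonds are edges of the torus graph (`L ≥ 2`). [cite: LiebNachtergaele1995, eq. (1.9)] -/
theorem bond_mem_edgeFinset (h2 : 2 ≤ L) (b : Bond d L) : bond b ∈ (torusGraph d L).edgeFinset := by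
  rw [bond, SimpleGraph.mem_edgeFinset, SimpleGraph.mem_edgeSet]
  exact adj_bond h2 b

/-- Every edge of the torus graph is a bond. [cite: LiebNachtergaele1995, eq. (1.9)] -/
theorem exists_eq_bond {e : Sym2 (TorusSite d L)} (he : e ∈ (torusGraph d L).edgeFinset) :
    ∃ b : Bond d L, e = bond b := by
  induction e using Sym2.ind with
  | h x y =>
    rw [SimpleGraph.mem_edgeFinset, SimpleGraph.mem_edgeSet, torusGraph_adj_iff] at he
    obtain ⟨-, ⟨i, rfl⟩ | ⟨i, rfl⟩⟩ := he
    · exact ⟨(x, i), rfl⟩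
    · exact ⟨(y, i), Sym2.eq_swap⟩

/-- **Sums over the edges are sums over the bonds** (`L ≥ 3`). [cite: LiebNachtergaele1995, eq. (1.9)] -/
theorem sum_edgeFinset_eq_sum_bond (h3 : 3 ≤ L) {M : Type*} [AddCommMonoid M]
    (F : Sym2 (TorusSite d L) → M) :
    ∑ e ∈ (torusGraph d L).edgeFinset, F e = ∑ b : Bond d L, F (bond b) := by
  rw [← sum_pairs_eq_sum_edgeFinset' L h3, Fintype.sum_prod_type]
  rfl

/-- The coupling configuration `J` (`J_b` on the bond `b`) as a weight on unordered pairs of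
sites, zero off the bonds. [cite: LiebNachtergaele1995, eq. (1.9)] -/
def coupling (J : Bond d L → ℝ) : Sym2 (TorusSite d L) → ℝ :=
  Sym2.lift ⟨fun x y => ∑ k, ((if y = x + unitVec k then J (x, k) else 0) +
      (if x = y + unitVec k then J (y, k) else 0)),
    fun _ _ => sum_congr rfl fun _ _ => add_comm _ _⟩

omit [NeZero L] in
/-- `coupling J {x, x + e_k} = J_{(x,k)}` (`L ≥ 3`). [cite: LiebNachtergaele1995, eq. (1.9)] -/
theorem coupling_bond (h3 : 3 ≤ L) (J : Bond d L → ℝ) (b : Bond d L) : coupling J (bond b) = J b := by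
  obtain ⟨x, j⟩ := b
  simp only [coupling, bond, Sym2.lift_mk, sum_add_distrib]
  have h1 : ∑ k, (if x + unitVec j = x + unitVec k then J (x, k) else 0) = J (x, j) := by
    have : ∀ k, (x + unitVec j = x + (unitVec k : TorusSite d L)) ↔ j = k := fun k => by
      rw [add_right_inj, unitVec_inj (by omega)]
    simp only [this, sum_ite_eq, mem_univ, if_true]
  have h2 : ∑ k, (if x = x + unitVec j + unitVec k then J (x + unitVec j, k) else 0) = 0 := by
    refine sum_eq_zero fun k _ => if_neg fun h => unitVec_add_unitVec_ne_zero h3 j k ?_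
    have := congrArg (· - x) h
    simp only [sub_self, add_assoc, add_sub_cancel_left] at this
    exact this.symm
  rw [h1, h2, add_zero]

omit [NeZero L] in
/-- Antiferromagnetic couplings give a nonnegative weight. [cite: LiebNachtergaele1995, eq. (1.9)] -/
theorem coupling_nonneg {J : Bond d L → ℝ} (hJ : ∀ b, 0 ≤ J b) (e : Sym2 (TorusSite d L)) :
    0 ≤ coupling J e := by
  induction e using Sym2.ind with
  | h x y =>
    simp only [coupling, Sym2.lift_mk]
    exact sum_nonneg fun k _ => add_nonneg (by split_ifs <;> simp [hJ]) (by split_ifs <;> simp [hJ])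

/-- **The spin-Peierls Hamiltonian** `Σ_{⟨xy⟩} J_{xy} 𝐒_x·𝐒_y` on `(ℤ/Lℤ)^d`, spin `n/2`
(eq. (1.9) without the elastic term). [cite: LiebNachtergaele1995, eq. (1.9)] -/
def hamiltonian (n : ℕ) (J : Bond d L → ℝ) : Op (TorusSite d L) (n + 1) :=
  heisWeightedHamiltonian L n (coupling J)

/-- **The spin-Peierls energy** `λ₀(Σ_{⟨xy⟩} J_{xy} 𝐒_x·𝐒_y) + Σ_{⟨xy⟩} f(J_{xy})` (the smallest
eigenvalue of `H_Λ` of eq. (1.9)). [cite: LiebNachtergaele1995, eq. (1.9)] -/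
def energy (n : ℕ) (f : ℝ → ℝ) (J : Bond d L → ℝ) : ℝ :=
  (hamiltonian n J).groundEnergy + ∑ b, f (J b)

/-- **Minimisers** of the spin-Peierls energy among the antiferromagnetic coupling
configurations `J ≥ 0`. [cite: LiebNachtergaele1995, Theorem 4] -/
def IsMinimizer (n : ℕ) (f : ℝ → ℝ) (J : Bond d L → ℝ) : Prop :=
  (∀ b, 0 ≤ J b) ∧ ∀ J' : Bond d L → ℝ, (∀ b, 0 ≤ J' b) → energy n f J ≤ energy n f J'

/-- **Periodicity 2 in all coordinate directions.** [cite: LiebNachtergaele1995, Theorem 4] -/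
def IsPeriodTwo (J : Bond d L → ℝ) : Prop :=
  ∀ (x : TorusSite d L) (k i : Fin d), J (x + unitVec i + unitVec i, k) = J (x, k)

/-- A minimiser is antiferromagnetic. [cite: LiebNachtergaele1995, Theorem 4] -/
theorem IsMinimizer.nonneg {n : ℕ} {f : ℝ → ℝ} {J : Bond d L → ℝ} (h : IsMinimizer n f J) (b : Bond d L) :
    0 ≤ J b := h.1 b

/-- A minimiser minimises. [cite: LiebNachtergaele1995, Theorem 4] -/
theorem IsMinimizer.le {n : ℕ} {f : ℝ → ℝ} {J : Bond d L → ℝ} (h : IsMinimizer n f J)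
    {J' : Bond d L → ℝ} (hJ' : ∀ b, 0 ≤ J' b) : energy n f J ≤ energy n f J' := h.2 J' hJ'

/-- The weighted Hamiltonian only sees the weight on the edges. [cite: KLS1988JSP, eq. (5)] -/
theorem heisWeightedHamiltonian_congr_edges (n : ℕ) {w₁ w₂ : Sym2 (TorusSite d L) → ℝ}
    (h : ∀ e ∈ (torusGraph d L).edgeFinset, w₁ e = w₂ e) :
    heisWeightedHamiltonian L n w₁ = heisWeightedHamiltonian L n w₂ := by
  unfold heisWeightedHamiltonian
  exact sum_congr rfl fun e he => by rw [h e he]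

/-! ### The planes between sites: left, right and cut bonds, and the reflection of the bonds -/

section Plane

variable (i : Fin d) (a : ZMod L)

/-- Bond with both endpoints in the left half of the planes `(a | a+1)`, `(a+L/2 | a+L/2+1)` of
direction `i`. [cite: LiebNachtergaele1995, §3 (`J^(l)`)] -/
abbrev IsLB (b : Bond d L) : Prop :=
  b.1 ∈ torusLeftHalf L i a ∧ b.1 + unitVec b.2 ∈ torusLeftHalf L i a

/-- Bond with both endpoints in the right half. [cite: LiebNachtergaele1995, §3 (`J^(r)`)] -/
abbrev IsRB (b : Bond d L) : Prop :=
  b.1 ∉ torusLeftHalf L i a ∧ b.1 + unitVec b.2 ∉ torusLeftHalf L i a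

/-- **The reflection of the bonds** in the planes of direction `i` at `a`: transverse bonds
`{x, x+e_k} ↦ {θx, θx+e_k}`, parallel bonds `{x, x+e_i} ↦ {θx - e_i, θx}`.
[cite: LiebNachtergaele1995, §3] -/
def bondRefl (b : Bond d L) : Bond d L :=
  if b.2 = i then (Torus.reflectBetweenSites i a b.1 - unitVec i, b.2)
  else (Torus.reflectBetweenSites i a b.1, b.2)

variable {i a}

omit [NeZero L] in
/-- `θ(x + e_i) = θx - e_i`. [cite: DLS1978, §2] -/
theorem reflect_add_unitVec_self (x : TorusSite d L) :
    Torus.reflectBetweenSites i a (x + unitVec i) = Torus.reflectBetweenSites i a x - unitVec i :=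
  reflectBetweenSites_add_single_self L i a x

omit [NeZero L] in
/-- `θ(x - e_i) = θx + e_i`. [cite: DLS1978, §2] -/
theorem reflect_sub_unitVec_self (x : TorusSite d L) :
    Torus.reflectBetweenSites i a (x - unitVec i) = Torus.reflectBetweenSites i a x + unitVec i := by
  have h := reflect_add_unitVec_self (i := i) (a := a) (x - unitVec i)
  rw [sub_add_cancel] at h
  rw [h, sub_add_cancel]

omit [NeZero L] in
/-- `θ(x + e_k) = θx + e_k` for `k ≠ i`. [cite: DLS1978, §2] -/
theorem reflect_add_unitVec_of_ne (x : TorusSite d L) {k : Fin d} (hk : k ≠ i) :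
    Torus.reflectBetweenSites i a (x + unitVec k) = Torus.reflectBetweenSites i a x + unitVec k :=
  reflectBetweenSites_add_single_of_ne L i a x hk

/-- Transverse steps stay in the same half. [cite: KLS1988JSP, p. 1027] -/
theorem add_unitVec_mem_iff_of_ne (x : TorusSite d L) {k : Fin d} (hk : k ≠ i) :
    x + unitVec k ∈ torusLeftHalf L i a ↔ x ∈ torusLeftHalf L i a := by
  rw [mem_torusLeftHalf, mem_torusLeftHalf, Pi.add_apply, unitVec_apply_of_ne (Ne.symm hk) , add_zero]

/-- A transverse bond is left iff its lower endpoint is. [cite: LiebNachtergaele1995, §3] -/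
theorem isLB_iff_of_ne {b : Bond d L} (hk : b.2 ≠ i) : IsLB i a b ↔ b.1 ∈ torusLeftHalf L i a := by
  rw [IsLB, add_unitVec_mem_iff_of_ne _ hk, and_self]

/-- A transverse bond is right iff its lower endpoint is not left. [cite: LiebNachtergaele1995, §3] -/
theorem isRB_iff_of_ne {b : Bond d L} (hk : b.2 ≠ i) : IsRB i a b ↔ b.1 ∉ torusLeftHalf L i a := by
  rw [IsRB, add_unitVec_mem_iff_of_ne _ hk, and_self]

/-- Left bonds are not right bonds. [cite: LiebNachtergaele1995, §3] -/
theorem IsLB.not_isRB {b : Bond d L} (h : IsLB i a b) : ¬IsRB i a b := fun h' => h'.1 h.1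

omit [NeZero L] in
/-- The endpoints of the reflected bond are the mirror images of the endpoints.
[cite: LiebNachtergaele1995, §3] -/
theorem bondRefl_fst_snd (b : Bond d L) :
    ((bondRefl i a b).1 = Torus.reflectBetweenSites i a b.1 ∧
        (bondRefl i a b).1 + unitVec (bondRefl i a b).2 = Torus.reflectBetweenSites i a (b.1 + unitVec b.2)) ∨
      ((bondRefl i a b).1 = Torus.reflectBetweenSites i a (b.1 + unitVec b.2) ∧
        (bondRefl i a b).1 + unitVec (bondRefl i a b).2 = Torus.reflectBetweenSites i a b.1) := by
  by_cases hk : b.2 = i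
  · right
    rw [bondRefl, if_pos hk, hk, reflect_add_unitVec_self, sub_add_cancel]
    exact ⟨rfl, rfl⟩
  · left
    rw [bondRefl, if_neg hk, reflect_add_unitVec_of_ne _ hk]
    exact ⟨rfl, rfl⟩

omit [NeZero L] in
/-- The reflected bond, as an unordered pair, is the mirror image of the bond.
[cite: LiebNachtergaele1995, §3] -/
theorem bond_bondRefl (b : Bond d L) :
    bond (bondRefl i a b) = (bond b).map (Torus.reflectBetweenSites i a) := by
  rw [bond, bond, Sym2.map_mk]
  rcases bondRefl_fst_snd (i := i) (a := a) b with ⟨h1, h2⟩ | ⟨h1, h2⟩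
  · rw [h2, h1]
  · rw [h2, h1, Sym2.eq_swap]

omit [NeZero L] in
/-- `bondRefl` is an involution. [cite: LiebNachtergaele1995, §3] -/
theorem bondRefl_bondRefl (b : Bond d L) : bondRefl i a (bondRefl i a b) = b := by
  obtain ⟨x, k⟩ := b
  by_cases hk : k = i
  · simp only [bondRefl, hk, if_true, reflect_sub_unitVec_self, reflectBetweenSites_reflectBetweenSites,
      add_sub_cancel_right]
  · simp only [bondRefl, hk, if_false, reflectBetweenSites_reflectBetweenSites]

/-- The reflection maps left bonds to right bonds. [cite: LiebNachtergaele1995, §3] -/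
theorem isRB_bondRefl (hL : Even L) {b : Bond d L} (h : IsLB i a b) : IsRB i a (bondRefl i a b) := by
  rcases bondRefl_fst_snd (i := i) (a := a) b with ⟨h1, h2⟩ | ⟨h1, h2⟩
  · rw [IsRB, h2, h1, reflectBetweenSites_mem_torusLeftHalf_iff L i a hL,
      reflectBetweenSites_mem_torusLeftHalf_iff L i a hL, not_not, not_not]
    exact h
  · rw [IsRB, h2, h1, reflectBetweenSites_mem_torusLeftHalf_iff L i a hL,
      reflectBetweenSites_mem_torusLeftHalf_iff L i a hL, not_not, not_not]
    exact ⟨h.2, h.1⟩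

/-- The reflection maps right bonds to left bonds. [cite: LiebNachtergaele1995, §3] -/
theorem isLB_bondRefl (hL : Even L) {b : Bond d L} (h : IsRB i a b) : IsLB i a (bondRefl i a b) := by
  rcases bondRefl_fst_snd (i := i) (a := a) b with ⟨h1, h2⟩ | ⟨h1, h2⟩
  · rw [IsLB, h2, h1, reflectBetweenSites_mem_torusLeftHalf_iff L i a hL,
      reflectBetweenSites_mem_torusLeftHalf_iff L i a hL]
    exact h
  · rw [IsLB, h2, h1, reflectBetweenSites_mem_torusLeftHalf_iff L i a hL,
      reflectBetweenSites_mem_torusLeftHalf_iff L i a hL]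
    exact ⟨h.2, h.1⟩

/-- **A bond crossing the planes is its own mirror image.** [cite: LiebNachtergaele1995, §3 (`J^(m)`)] -/
theorem bondRefl_eq_self_of_cut (hL : Even L) (h2 : 2 ≤ L) {b : Bond d L} (hl : ¬IsLB i a b)
    (hr : ¬IsRB i a b) : bondRefl i a b = b := by
  obtain ⟨x, k⟩ := b
  by_cases hk : k = i
  · subst hk
    simp only [IsLB, IsRB, not_and_or, not_not] at hl hr
    by_cases hx : x ∈ torusLeftHalf L k a
    · have hy : x + unitVec k ∉ torusLeftHalf L k a := by
        rcases hl with h | h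
        · exact absurd hx h
        · exact h
      have h := eq_reflectBetweenSites_of_adj L k a hL hx hy (adj_bond h2 (x, k))
      simp only [bondRefl, if_true, ← h, add_sub_cancel_right]
    · have hy : x + unitVec k ∈ torusLeftHalf L k a := by
        rcases hr with h | h
        · exact absurd h hx
        · exact h
      have h := eq_reflectBetweenSites_of_adj L k a hL hy hx (adj_bond h2 (x, k)).symm
      rw [reflect_add_unitVec_self] at h
      simp only [bondRefl, if_true, ← h]
  · exfalso
    rw [isLB_iff_of_ne hk] at hl
    rw [isRB_iff_of_ne hk] at hr
    exact hr hl

omit [NeZero L] in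
/-- Membership of the endpoints of a bond. [cite: LiebNachtergaele1995, eq. (1.9)] -/
theorem forall_mem_bond {p : TorusSite d L → Prop} (b : Bond d L) :
    (∀ y ∈ bond b, p y) ↔ p b.1 ∧ p (b.1 + unitVec b.2) := by
  simp only [bond, Sym2.mem_iff, or_imp, forall_and, forall_eq]

/-- **The reflected weight of `HeisenbergCouplingReflection` on the bonds is the left-symmetrised
coupling configuration.** [cite: LiebNachtergaele1995, §3 (proof of Theorem 4)] -/
theorem reflectWeightLeft_coupling_bond (h3 : 3 ≤ L) (J : Bond d L → ℝ) (b : Bond d L) :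
    reflectWeightLeft L i a (coupling J) (bond b) = SymCount.symL (IsRB i a) (bondRefl i a) J b := by
  by_cases h : IsRB i a b
  · rw [reflectWeightLeft_apply,
      if_pos ((forall_mem_bond (p := fun y => y ∉ torusLeftHalf L i a) b).2 h), SymCount.symL, if_pos h,
      ← bond_bondRefl, coupling_bond h3]
  · rw [reflectWeightLeft_apply,
      if_neg (fun h' => h ((forall_mem_bond (p := fun y => y ∉ torusLeftHalf L i a) b).1 h')),
      SymCount.symL, if_neg h, coupling_bond h3]

/-- Same for the right symmetrisation. [cite: LiebNachtergaele1995, §3 (proof of Theorem 4)] -/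
theorem reflectWeightRight_coupling_bond (h3 : 3 ≤ L) (J : Bond d L → ℝ) (b : Bond d L) :
    reflectWeightRight L i a (coupling J) (bond b) = SymCount.symR (IsLB i a) (bondRefl i a) J b := by
  by_cases h : IsLB i a b
  · rw [reflectWeightRight_apply,
      if_pos ((forall_mem_bond (p := fun y => y ∈ torusLeftHalf L i a) b).2 h), SymCount.symR, if_pos h,
      ← bond_bondRefl, coupling_bond h3]
  · rw [reflectWeightRight_apply,
      if_neg (fun h' => h ((forall_mem_bond (p := fun y => y ∈ torusLeftHalf L i a) b).1 h')),
      SymCount.symR, if_neg h, coupling_bond h3]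

/-- The Hamiltonian of the reflected weight is the Hamiltonian of the left-symmetrised couplings.
[cite: LiebNachtergaele1995, §3 (proof of Theorem 4)] -/
theorem hamiltonian_symL (h3 : 3 ≤ L) (n : ℕ) (J : Bond d L → ℝ) :
    heisWeightedHamiltonian L n (reflectWeightLeft L i a (coupling J)) =
      hamiltonian n (SymCount.symL (IsRB i a) (bondRefl i a) J) := by
  refine heisWeightedHamiltonian_congr_edges n fun e he => ?_
  obtain ⟨b, rfl⟩ := exists_eq_bond he
  rw [reflectWeightLeft_coupling_bond h3, coupling_bond h3]

/-- The Hamiltonian of the reflected weight is the Hamiltonian of the right-symmetrised couplings.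
[cite: LiebNachtergaele1995, §3 (proof of Theorem 4)] -/
theorem hamiltonian_symR (h3 : 3 ≤ L) (n : ℕ) (J : Bond d L → ℝ) :
    heisWeightedHamiltonian L n (reflectWeightRight L i a (coupling J)) =
      hamiltonian n (SymCount.symR (IsLB i a) (bondRefl i a) J) := by
  refine heisWeightedHamiltonian_congr_edges n fun e he => ?_
  obtain ⟨b, rfl⟩ := exists_eq_bond he
  rw [reflectWeightRight_coupling_bond h3, coupling_bond h3]

/-- **The reflection inequality of the proof of Theorem 4**: for antiferromagnetic couplings and
every pair of planes between sites, `𝓔(J^l, J^m, θJ^l) + 𝓔(θJ^r, J^m, J^r) ≤ 2 𝓔(J)` — the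
magnetic part is Dyson–Lieb–Simon reflection positivity in the couplings
(`heis_groundEnergy_reflectWeight_le_zero`), the elastic part is split evenly.
[cite: LiebNachtergaele1995, §3 (proof of Theorem 4, displayed inequality)] [cite: DLS1978, Thm. 6.1] -/
theorem energy_symL_add_energy_symR_le (hL : Even L) (h4 : 4 ≤ L) (n : ℕ) (f : ℝ → ℝ)
    {J : Bond d L → ℝ} (hJ : ∀ b, 0 ≤ J b) :
    energy n f (SymCount.symL (IsRB i a) (bondRefl i a) J) +
        energy n f (SymCount.symR (IsLB i a) (bondRefl i a) J) ≤ 2 * energy n f J := by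
  have h3 : 3 ≤ L := by omega
  have hmag := heis_groundEnergy_reflectWeight_le_zero L i a n hL h3 (w := coupling J)
    (fun x _ => coupling_nonneg hJ _)
  rw [hamiltonian_symL h3, hamiltonian_symR h3] at hmag
  have hel := SymCount.sum_symL_add_sum_symR (IsLB i a) (IsRB i a) (bondRefl i a)
    (fun b hb => isRB_bondRefl hL hb) (fun b hb => isLB_bondRefl hL hb) bondRefl_bondRefl J f
  unfold energy
  unfold hamiltonian at hmag ⊢
  linarith

/-- Both symmetrised configurations of a minimiser are minimisers.
[cite: LiebNachtergaele1995, §3 (proofs of Theorems 1 and 4: "and also be minimizing")] -/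
theorem IsMinimizer.symLR (hL : Even L) (h4 : 4 ≤ L) {n : ℕ} {f : ℝ → ℝ} {J : Bond d L → ℝ}
    (h : IsMinimizer n f J) :
    IsMinimizer n f (SymCount.symL (IsRB i a) (bondRefl i a) J) ∧
      IsMinimizer n f (SymCount.symR (IsLB i a) (bondRefl i a) J) := by
  have hle := energy_symL_add_energy_symR_le (i := i) (a := a) hL h4 n f h.1
  have hL0 : ∀ b, 0 ≤ SymCount.symL (IsRB i a) (bondRefl i a) J b := fun b => by
    rw [SymCount.symL]; split_ifs <;> exact h.1 _
  have hR0 : ∀ b, 0 ≤ SymCount.symR (IsLB i a) (bondRefl i a) J b := fun b => by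
    rw [SymCount.symR]; split_ifs <;> exact h.1 _
  have h₁ := h.le hL0
  have h₂ := h.le hR0
  exact ⟨⟨hL0, fun J' hJ' => by linarith [h.le hJ']⟩, ⟨hR0, fun J' hJ' => by linarith [h.le hJ']⟩⟩

end Plane

/-! ### The pairs `(b, b + s_i(b))` and their transport under the reflections -/

section Pairs

/-- The translation of the pair in direction `i`: `2e_i` for the bonds parallel to `e_i`, `e_i`
for the transverse ones. [cite: LiebNachtergaele1995, §3 (proof of Theorem 1: pairs `(j, j+2)`)] -/
def shiftVec (i k : Fin d) : TorusSite d L := if k = i then unitVec i + unitVec i else unitVec i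

/-- **The partner of the bond `b` in direction `i`**: `b + 2e_i` (parallel) or `b + e_i`
(transverse). [cite: LiebNachtergaele1995, §3] -/
def shift (i : Fin d) (b : Bond d L) : Bond d L := (b.1 + shiftVec i b.2, b.2)

omit [NeZero L] in
/-- Unfolding lemma. [cite: LiebNachtergaele1995, §3] -/
theorem shift_fst (i : Fin d) (b : Bond d L) : (shift i b).1 = b.1 + shiftVec i b.2 := rfl

omit [NeZero L] in
/-- Unfolding lemma. [cite: LiebNachtergaele1995, §3] -/
@[simp] theorem shift_snd (i : Fin d) (b : Bond d L) : (shift i b).2 = b.2 := rfl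

variable {i : Fin d} {a : ZMod L}

omit [NeZero L] in
/-- The reflection of direction `i` reverses the pair translation of direction `i`:
`θ(x + s) = θx - s`. [cite: DLS1978, §2] -/
theorem reflect_add_shiftVec_self (x : TorusSite d L) (k : Fin d) :
    Torus.reflectBetweenSites i a (x + shiftVec i k) = Torus.reflectBetweenSites i a x - shiftVec i k := by
  by_cases hk : k = i
  · simp only [shiftVec, hk, if_true, ← add_assoc, reflect_add_unitVec_self]
    abel
  · simp only [shiftVec, hk, if_false, reflect_add_unitVec_self]

omit [NeZero L] in
/-- The reflection of direction `i` commutes with the pair translations of the other directions.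
[cite: DLS1978, §2] -/
theorem reflect_add_shiftVec_of_ne (x : TorusSite d L) (k : Fin d) {i' : Fin d} (hi' : i' ≠ i) :
    Torus.reflectBetweenSites i a (x + shiftVec i' k) = Torus.reflectBetweenSites i a x + shiftVec i' k := by
  by_cases hk : k = i'
  · simp only [shiftVec, hk, if_true, ← add_assoc, reflect_add_unitVec_of_ne _ hi']
  · simp only [shiftVec, hk, if_false, reflect_add_unitVec_of_ne _ hi']

omit [NeZero L] in
/-- `bondRefl` of a translated bond, same direction: `ρ(b + s) = ρ(b) - s`.
[cite: LiebNachtergaele1995, §3] -/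
theorem bondRefl_shift_self (b : Bond d L) :
    bondRefl i a (shift i b) = ((bondRefl i a b).1 - shiftVec i b.2, b.2) := by
  obtain ⟨x, k⟩ := b
  by_cases hk : k = i
  · simp only [bondRefl, shift, hk, if_true, reflect_add_shiftVec_self, sub_right_comm]
  · simp only [bondRefl, shift, hk, if_false, reflect_add_shiftVec_self]

omit [NeZero L] in
/-- `bondRefl` of a translated bond, other direction: `ρ(b + s) = ρ(b) + s`.
[cite: LiebNachtergaele1995, §3] -/
theorem bondRefl_shift_of_ne (b : Bond d L) {i' : Fin d} (hi' : i' ≠ i) :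
    bondRefl i a (shift i' b) = shift i' (bondRefl i a b) := by
  obtain ⟨x, k⟩ := b
  by_cases hk : k = i
  · simp only [bondRefl, shift, hk, if_true, reflect_add_shiftVec_of_ne _ _ hi', add_sub_right_comm]
  · simp only [bondRefl, shift, hk, if_false, reflect_add_shiftVec_of_ne _ _ hi']

/-- The transport of the pairs of direction `i` under the reflection of direction `i`
(orientation reversed): `b ↦ ρ(b + s)`. [cite: LiebNachtergaele1995, §3] -/
def pairReflSelf (i : Fin d) (a : ZMod L) (b : Bond d L) : Bond d L := bondRefl i a (shift i b)

omit [NeZero L] in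
/-- `shift i (pairReflSelf b) = ρ b`. [cite: LiebNachtergaele1995, §3] -/
theorem shift_pairReflSelf (b : Bond d L) : shift i (pairReflSelf i a b) = bondRefl i a b := by
  rw [pairReflSelf, bondRefl_shift_self, shift]
  refine Prod.ext ?_ ?_
  · simp only [sub_add_cancel]
  · -- the direction of `bondRefl i a b` is that of `b`
    unfold bondRefl; split_ifs <;> rfl

omit [NeZero L] in
/-- `pairReflSelf` is an involution. [cite: LiebNachtergaele1995, §3] -/
theorem pairReflSelf_pairReflSelf (b : Bond d L) : pairReflSelf i a (pairReflSelf i a b) = b := by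
  rw [pairReflSelf, shift_pairReflSelf, bondRefl_bondRefl]

/-- Straddling parallel/transverse pairs of direction `i` are mirror pairs: if `b` is a left
bond and its partner `b + s_i(b)` a right bond then `b + s_i(b) = ρ b`.
[cite: LiebNachtergaele1995, §3 (proof of Theorem 1)] -/
theorem shift_eq_bondRefl_of_isLB_of_isRB (hL : Even L) (h2 : 2 ≤ L) {b : Bond d L}
    (hl : IsLB i a b) (hr : IsRB i a (shift i b)) : shift i b = bondRefl i a b := by
  obtain ⟨x, k⟩ := b
  by_cases hk : k = i
  · subst hk
    -- parallel: the middle bond `{x + e, x + 2e}` crosses the plane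
    simp only [IsLB, IsRB, shift, shiftVec, if_true] at hl hr
    have hx1 : x + unitVec k ∈ torusLeftHalf L k a := hl.2
    have hx2 : x + unitVec k + unitVec k ∉ torusLeftHalf L k a := by rw [add_assoc]; exact hr.1
    have h := eq_reflectBetweenSites_of_adj L k a hL hx1 hx2 (adj_bond h2 (x + unitVec k, k))
    rw [reflect_add_unitVec_self] at h
    simp only [shift, shiftVec, bondRefl, if_true, ← h, add_assoc]
  · -- transverse: the bond `{x, x + e_i}`... i.e. `x` left and `x + e_i` right
    rw [isLB_iff_of_ne hk] at hl
    rw [isRB_iff_of_ne (by exact hk)] at hr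
    simp only [shift, shiftVec, hk, if_false] at hr ⊢
    have h := eq_reflectBetweenSites_of_adj L i a hL hl hr (adj_bond h2 (x, i))
    simp only [bondRefl, hk, if_false, h]

/-- … and symmetrically: `b` right, partner left. [cite: LiebNachtergaele1995, §3 (proof of Theorem 1)] -/
theorem shift_eq_bondRefl_of_isRB_of_isLB (hL : Even L) (h2 : 2 ≤ L) {b : Bond d L}
    (hr : IsRB i a b) (hl : IsLB i a (shift i b)) : shift i b = bondRefl i a b := by
  obtain ⟨x, k⟩ := b
  by_cases hk : k = i
  · subst hk
    simp only [IsLB, IsRB, shift, shiftVec, if_true] at hl hr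
    have hx1 : x + unitVec k ∉ torusLeftHalf L k a := hr.2
    have hx2 : x + unitVec k + unitVec k ∈ torusLeftHalf L k a := by rw [add_assoc]; exact hl.1
    have h := eq_reflectBetweenSites_of_adj L k a hL hx2 hx1 (adj_bond h2 (x + unitVec k, k)).symm
    rw [reflect_add_unitVec_self, reflect_add_unitVec_self] at h
    -- `x + e = θx - e - e`, i.e. `θx - e = x + e + e`
    have h' : Torus.reflectBetweenSites k a x - unitVec k = x + unitVec k + unitVec k := by
      rw [h]; abel
    simp only [shift, shiftVec, bondRefl, if_true, h', add_assoc]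
  · rw [isRB_iff_of_ne hk] at hr
    rw [isLB_iff_of_ne (by exact hk)] at hl
    simp only [shift, shiftVec, hk, if_false] at hl ⊢
    have h := eq_reflectBetweenSites_of_adj L i a hL hl hr (adj_bond h2 (x, i)).symm
    rw [reflect_add_unitVec_self] at h
    have h' : Torus.reflectBetweenSites i a x = x + unitVec i := (eq_sub_iff_add_eq.1 h).symm
    simp only [bondRefl, hk, if_false, h']

/-- Pairs of another direction never straddle the planes of direction `i`: the translation by a
transverse vector preserves the class of a bond. [cite: LiebNachtergaele1995, §3] -/
theorem isLB_shift_of_ne {b : Bond d L} {i' : Fin d} (hi' : i' ≠ i) : IsLB i a (shift i' b) ↔ IsLB i a b := by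
  have hv : ∀ y : TorusSite d L, y + shiftVec i' b.2 ∈ torusLeftHalf L i a ↔ y ∈ torusLeftHalf L i a := by
    intro y
    by_cases hk : b.2 = i'
    · rw [shiftVec, if_pos hk, ← add_assoc, add_unitVec_mem_iff_of_ne _ hi', add_unitVec_mem_iff_of_ne _ hi']
    · rw [shiftVec, if_neg hk, add_unitVec_mem_iff_of_ne _ hi']
  rw [IsLB, IsLB, shift_fst, shift_snd, add_right_comm, hv, hv]

/-- Same for right bonds. [cite: LiebNachtergaele1995, §3] -/
theorem isRB_shift_of_ne {b : Bond d L} {i' : Fin d} (hi' : i' ≠ i) : IsRB i a (shift i' b) ↔ IsRB i a b := by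
  have hv : ∀ y : TorusSite d L, y + shiftVec i' b.2 ∈ torusLeftHalf L i a ↔ y ∈ torusLeftHalf L i a := by
    intro y
    by_cases hk : b.2 = i'
    · rw [shiftVec, if_pos hk, ← add_assoc, add_unitVec_mem_iff_of_ne _ hi', add_unitVec_mem_iff_of_ne _ hi']
    · rw [shiftVec, if_neg hk, add_unitVec_mem_iff_of_ne _ hi']
  rw [IsRB, IsRB, shift_fst, shift_snd, add_right_comm, hv, hv]

/-- **The pair-count inequality for one direction of pairs** under the reflections of direction
`i` at `a` (the abstract count `SymCount.eqCount_symL_add` instantiated on the torus).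
[cite: LiebNachtergaele1995, §3 (proofs of Theorems 1 and 4)] -/
theorem eqCount_symL_add_torus (hL : Even L) (h2 : 2 ≤ L) (i' : Fin d) (J : Bond d L → ℝ) :
    SymCount.eqCount (shift i') (SymCount.symL (IsRB i a) (bondRefl i a) J) +
        SymCount.eqCount (shift i') (SymCount.symR (IsLB i a) (bondRefl i a) J) +
        2 * #((univ.filter (SymCount.Mixed (IsLB i a) (IsRB i a) (shift i'))).filter
          fun b => J (shift i' b) = J b) =
      2 * SymCount.eqCount (shift i') J +
        2 * #(univ.filter (SymCount.Mixed (IsLB i a) (IsRB i a) (shift i'))) := by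
  by_cases hi' : i' = i
  · subst hi'
    exact SymCount.eqCount_symL_add (IsLB i' a) (IsRB i' a) (fun b hb => hb.not_isRB) (bondRefl i' a)
      (fun b hb => isRB_bondRefl hL hb) (fun b hb => isLB_bondRefl hL hb)
      (fun b hl hr => bondRefl_eq_self_of_cut hL h2 hl hr) bondRefl_bondRefl (shift i') (pairReflSelf i' a)
      pairReflSelf_pairReflSelf (fun b => Or.inr ⟨rfl, shift_pairReflSelf b⟩)
      (fun b hl hr => shift_eq_bondRefl_of_isLB_of_isRB hL h2 hl hr)
      (fun b hr hl => shift_eq_bondRefl_of_isRB_of_isLB hL h2 hr hl) J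
  · exact SymCount.eqCount_symL_add (IsLB i a) (IsRB i a) (fun b hb => hb.not_isRB) (bondRefl i a)
      (fun b hb => isRB_bondRefl hL hb) (fun b hb => isLB_bondRefl hL hb)
      (fun b hl hr => bondRefl_eq_self_of_cut hL h2 hl hr) bondRefl_bondRefl (shift i') (bondRefl i a)
      bondRefl_bondRefl (fun b => Or.inl ⟨rfl, (bondRefl_shift_of_ne b hi').symm⟩)
      (fun b hl hr => absurd ((isRB_shift_of_ne hi').1 hr) hl.not_isRB)
      (fun b hr hl => absurd hr ((isLB_shift_of_ne hi').1 hl).not_isRB) J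

end Pairs

/-! ### The potential `Φ` and the descent -/

section Descent

/-- **The potential of the descent**: the total number of coinciding pairs
`Φ(J) = Σ_i #{b : J(b + s_i(b)) = J(b)}`. [cite: LiebNachtergaele1995, §3 (proofs of Theorems 1 and 4)] -/
def potential (J : Bond d L → ℝ) : ℕ := ∑ i : Fin d, SymCount.eqCount (shift i) J

/-- `Φ ≤ d · #bonds`. [cite: LiebNachtergaele1995, §3] -/
theorem potential_le (J : Bond d L → ℝ) : potential J ≤ d * Fintype.card (Bond d L) := by
  unfold potential
  calc ∑ i : Fin d, SymCount.eqCount (shift i) J ≤ ∑ _i : Fin d, Fintype.card (Bond d L) :=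
        sum_le_sum fun i _ => SymCount.eqCount_le _ _
    _ = d * Fintype.card (Bond d L) := by rw [sum_const, card_univ, Fintype.card_fin, smul_eq_mul]

/-- Maximal potential means that all pairs coincide. [cite: LiebNachtergaele1995, §3] -/
theorem forall_eq_of_le_potential {J : Bond d L → ℝ} (h : d * Fintype.card (Bond d L) ≤ potential J)
    (i : Fin d) (b : Bond d L) : J (shift i b) = J b := by
  refine SymCount.forall_eq_of_card_le_eqCount ?_ b
  by_contra hlt
  have hlt' : SymCount.eqCount (shift i) J < Fintype.card (Bond d L) := not_le.1 hlt
  have : potential J < d * Fintype.card (Bond d L) := by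
    unfold potential
    calc ∑ i' : Fin d, SymCount.eqCount (shift i') J
        < ∑ _i' : Fin d, Fintype.card (Bond d L) :=
          sum_lt_sum (fun i' _ => SymCount.eqCount_le _ _) ⟨i, mem_univ _, hlt'⟩
      _ = d * Fintype.card (Bond d L) := by rw [sum_const, card_univ, Fintype.card_fin, smul_eq_mul]
  omega

omit [NeZero L] in
/-- All pairs coincide ⇒ periodicity `2` in all coordinate directions (transverse pairs give
period `1`, parallel ones period `2`). [cite: LiebNachtergaele1995, Theorem 4] -/
theorem isPeriodTwo_of_forall_eq {J : Bond d L → ℝ} (h : ∀ (i : Fin d) (b : Bond d L), J (shift i b) = J b) :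
    IsPeriodTwo J := by
  intro x k i
  by_cases hk : k = i
  · have := h i (x, k)
    simp only [shift, shiftVec, hk, if_true, ← add_assoc] at this
    rw [hk]; exact this
  · have h1 := h i (x, k)
    have h2 := h i (x + unitVec i, k)
    simp only [shift, shiftVec, hk, if_false] at h1 h2
    rw [h2, h1]

/-- **One step of the descent at the planes of direction `i` at `a`**: both symmetrised
configurations of a minimiser are minimisers, together they have potential at least `2 Φ(J)`,
and at least `2 Φ(J) + 2` when a pair straddling the planes is unequal.
[cite: LiebNachtergaele1995, §3 (proofs of Theorems 1 and 4)] -/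
theorem step (hL : Even L) (h4 : 4 ≤ L) {n : ℕ} {f : ℝ → ℝ} {J : Bond d L → ℝ} (hmin : IsMinimizer n f J)
    (i : Fin d) (a : ZMod L) :
    ∃ J₁ J₂ : Bond d L → ℝ, IsMinimizer n f J₁ ∧ IsMinimizer n f J₂ ∧
      2 * potential J ≤ potential J₁ + potential J₂ ∧
      ((∃ (i' : Fin d) (b : Bond d L), SymCount.Mixed (IsLB i a) (IsRB i a) (shift i') b ∧ J (shift i' b) ≠ J b) →
        2 * potential J + 2 ≤ potential J₁ + potential J₂) := by
  have h2 : 2 ≤ L := by omega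
  refine ⟨_, _, (hmin.symLR (i := i) (a := a) hL h4).1, (hmin.symLR (i := i) (a := a) hL h4).2, ?_, ?_⟩
  · unfold potential
    rw [mul_sum, ← sum_add_distrib]
    refine sum_le_sum fun i' _ => ?_
    have h := eqCount_symL_add_torus (i := i) (a := a) hL h2 i' J
    have hle : #((univ.filter (SymCount.Mixed (IsLB i a) (IsRB i a) (shift i'))).filter
        fun b => J (shift i' b) = J b) ≤ #(univ.filter (SymCount.Mixed (IsLB i a) (IsRB i a) (shift i'))) :=
      card_filter_le _ _
    omega
  · rintro ⟨i₀, b₀, hb₀, hne⟩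
    unfold potential
    rw [mul_sum, ← sum_add_distrib]
    -- every direction contributes at least twice its count, direction `i₀` two more
    have hterm : ∀ i', 2 * SymCount.eqCount (shift i') J ≤
        SymCount.eqCount (shift i') (SymCount.symL (IsRB i a) (bondRefl i a) J) +
          SymCount.eqCount (shift i') (SymCount.symR (IsLB i a) (bondRefl i a) J) := by
      intro i'
      have h := eqCount_symL_add_torus (i := i) (a := a) hL h2 i' J
      have hle : #((univ.filter (SymCount.Mixed (IsLB i a) (IsRB i a) (shift i'))).filter
          fun b => J (shift i' b) = J b) ≤ #(univ.filter (SymCount.Mixed (IsLB i a) (IsRB i a) (shift i'))) :=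
        card_filter_le _ _
      omega
    have hterm₀ : 2 * SymCount.eqCount (shift i₀) J + 2 ≤
        SymCount.eqCount (shift i₀) (SymCount.symL (IsRB i a) (bondRefl i a) J) +
          SymCount.eqCount (shift i₀) (SymCount.symR (IsLB i a) (bondRefl i a) J) := by
      have h := eqCount_symL_add_torus (i := i) (a := a) hL h2 i₀ J
      have hlt : #((univ.filter (SymCount.Mixed (IsLB i a) (IsRB i a) (shift i₀))).filter
          fun b => J (shift i₀ b) = J b) < #(univ.filter (SymCount.Mixed (IsLB i a) (IsRB i a) (shift i₀))) := by
        refine card_lt_card ⟨filter_subset _ _, fun hsub => hne ?_⟩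
        have := hsub (mem_filter.2 ⟨mem_univ _, hb₀⟩)
        exact (mem_filter.1 this).2
      omega
    calc ∑ i', 2 * SymCount.eqCount (shift i') J + 2
        = ∑ i' ∈ univ.erase i₀, 2 * SymCount.eqCount (shift i') J + (2 * SymCount.eqCount (shift i₀) J + 2) := by
          rw [← sum_erase_add _ _ (mem_univ i₀)]; ring
      _ ≤ ∑ i' ∈ univ.erase i₀, (SymCount.eqCount (shift i') (SymCount.symL (IsRB i a) (bondRefl i a) J) +
            SymCount.eqCount (shift i') (SymCount.symR (IsLB i a) (bondRefl i a) J)) +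
          (SymCount.eqCount (shift i₀) (SymCount.symL (IsRB i a) (bondRefl i a) J) +
            SymCount.eqCount (shift i₀) (SymCount.symR (IsLB i a) (bondRefl i a) J)) :=
          add_le_add (sum_le_sum fun i' _ => hterm i') hterm₀
      _ = _ := sum_erase_add _ _ (mem_univ i₀)

omit [NeZero L] in
/-- `(-1).val = L - 1` and `(-2).val = L - 2` in `ℤ/Lℤ`. [cite: LiebNachtergaele1995, §3] -/
theorem val_neg_natCast {m : ℕ} (hm : m ≤ L) (hm0 : 0 < m) : (-(m : ZMod L)).val = L - m := by
  have h : (-(m : ZMod L)) = ((L - m : ℕ) : ZMod L) := by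
    rw [Nat.cast_sub hm, ZMod.natCast_self, zero_sub]
  rw [h, ZMod.val_natCast, Nat.mod_eq_of_lt (by omega)]

/-- **For every unequal pair there is a plane making it straddle** (the choice of the plane in
"the argument can be repeated"). [cite: LiebNachtergaele1995, §3 (proofs of Theorems 1 and 4)] -/
theorem exists_plane_mixed (h4 : 4 ≤ L) (i : Fin d) (b : Bond d L) :
    ∃ a : ZMod L, SymCount.Mixed (IsLB i a) (IsRB i a) (shift i) b := by
  obtain ⟨x, k⟩ := b
  by_cases hk : k = i
  · subst hk
    -- parallel pair `(x, x+e | x+2e, x+3e)`: the planes at `a = x_k + 1`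
    refine ⟨x k + 1, Or.inr ⟨?_, ?_⟩⟩
    · simp only [IsRB, mem_torusLeftHalf, Pi.add_apply, unitVec_apply_self, not_lt]
      constructor
      · rw [show x k - (x k + 1 + 1) = -((2 : ℕ) : ZMod L) by push_cast; ring, val_neg_natCast (by omega) (by omega)]
        omega
      · rw [show x k + 1 - (x k + 1 + 1) = -((1 : ℕ) : ZMod L) by push_cast; ring,
          val_neg_natCast (by omega) (by omega)]
        omega
    · simp only [IsLB, shift, shiftVec, if_true, mem_torusLeftHalf, Pi.add_apply, unitVec_apply_self]
      constructor
      · rw [show x k + (1 + 1) - (x k + 1 + 1) = 0 by ring, ZMod.val_zero]; omega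
      · rw [show x k + (1 + 1) + 1 - (x k + 1 + 1) = ((1 : ℕ) : ZMod L) by push_cast; ring, ZMod.val_natCast,
          Nat.mod_eq_of_lt (by omega)]
        omega
  · -- transverse pair `(x | x + e_i)`: the planes at `a = x_i`
    refine ⟨x i, Or.inr ⟨?_, ?_⟩⟩
    · rw [isRB_iff_of_ne hk, mem_torusLeftHalf, not_lt,
        show x i - (x i + 1) = -((1 : ℕ) : ZMod L) by push_cast; ring, val_neg_natCast (by omega) (by omega)]
      omega
    · rw [isLB_iff_of_ne (by exact hk), shift_fst, mem_torusLeftHalf]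
      simp only [shiftVec, hk, if_false, Pi.add_apply, unitVec_apply_self]
      rw [show x i + 1 - (x i + 1) = 0 by ring, ZMod.val_zero]
      omega

/-- **The descent**: from any minimiser, a minimiser all of whose pairs coincide.
[cite: LiebNachtergaele1995, §3 (proofs of Theorems 1 and 4)] -/
theorem exists_minimizer_forall_eq (hL : Even L) (h4 : 4 ≤ L) {n : ℕ} {f : ℝ → ℝ}
    {J : Bond d L → ℝ} (hmin : IsMinimizer n f J) :
    ∃ J' : Bond d L → ℝ, IsMinimizer n f J' ∧ ∀ (i : Fin d) (b : Bond d L), J' (shift i b) = J' b := by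
  suffices h : ∀ m : ℕ, ∀ J : Bond d L → ℝ, IsMinimizer n f J → d * Fintype.card (Bond d L) - potential J ≤ m →
      ∃ J' : Bond d L → ℝ, IsMinimizer n f J' ∧ ∀ (i : Fin d) (b : Bond d L), J' (shift i b) = J' b from
    h _ J hmin le_rfl
  intro m
  induction m with
  | zero =>
    intro J hJ hm
    exact ⟨J, hJ, forall_eq_of_le_potential (by omega)⟩
  | succ m ih =>
    intro J hJ hm
    by_cases hall : ∀ (i : Fin d) (b : Bond d L), J (shift i b) = J b
    · exact ⟨J, hJ, hall⟩
    · obtain ⟨i₀, hi₀⟩ := not_forall.1 hall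
      obtain ⟨b₀, hb₀⟩ := not_forall.1 hi₀
      obtain ⟨a, ha⟩ := exists_plane_mixed h4 i₀ b₀
      obtain ⟨J₁, J₂, h₁, h₂, -, hc⟩ := step hL h4 hJ i₀ a
      have hc' := hc ⟨i₀, b₀, ha, hb₀⟩
      have hlt : potential J < d * Fintype.card (Bond d L) := by
        by_contra hge
        exact hb₀ (forall_eq_of_le_potential (by omega) i₀ b₀)
      have hle₁ := potential_le J₁
      have hle₂ := potential_le J₂
      by_cases h1 : potential J + 1 ≤ potential J₁
      · exact ih J₁ h₁ (by omega)
      · exact ih J₂ h₂ (by omega)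

/-- **Theorem 4 of Lieb–Nachtergaele (dimerization for spin-Peierls).** On the torus `(ℤ/Lℤ)^d`
of even side `L ≥ 4` (any `d`, any spin `n/2`, any elastic energy `f`): if the minimum of
`λ₀(Σ_{⟨xy⟩} J_{xy} 𝐒_x·𝐒_y) + Σ_{⟨xy⟩} f(J_{xy})` over the antiferromagnetic coupling
configurations `J ≥ 0` is attained, then it is attained at a configuration of periodicity `2` in
all coordinate directions. [cite: LiebNachtergaele1995, Theorem 4] -/
theorem exists_periodTwo_minimizer (hL : Even L) (h4 : 4 ≤ L) (n : ℕ) (f : ℝ → ℝ)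
    {J : Bond d L → ℝ} (hmin : IsMinimizer n f J) :
    ∃ J' : Bond d L → ℝ, IsMinimizer n f J' ∧ energy n f J' = energy n f J ∧ IsPeriodTwo J' := by
  obtain ⟨J', h', hall⟩ := exists_minimizer_forall_eq hL h4 hmin
  exact ⟨J', h', le_antisymm (h'.le hmin.1) (hmin.le h'.1), isPeriodTwo_of_forall_eq hall⟩

end Descent

end SpinPeierls

end Literature.MathematicalPhysics.QuantumLattice

end
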